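import Summits.BirchSwinnertonDyer.Rank1Residual.X11b.Three.GoodReductionSubgroupNodeFrobenius
import Literature.NumberTheory.EllipticCurves.FrobeniusTwist
import Literature.NumberTheory.EllipticCurves.SplitNodeQuadraticProofs
import HarnessLib

/-!
# X11b at `p = 3` (team N8/O2), JET3-KUMMER (α), the `Ẽ_ns` half at a MULTIPLICATIVE place:
# the node reduction map `r : E₀(L) → k'ˣ` for a node PRESENTED OVER AN EXTENSION `k' ⊇ k` of
# the residue field, and its Galois behaviour (Silverman *AEC* Exercise 3.5(a)), in p1's
# `JetchevKummerAtP` dictionary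

HONEST FRAMING (cell `b2b-bsdres`, run/shared/lean/b2b/bsd-rank1-residual/, verbatim in every
file): the goal of the cell is to DELETE the COMBINATION-SHAPED residual classes of the
Birch–Swinnerton-Dyer formula for ALL analytic-rank `≤ 1` elliptic curves over `ℚ` — "full BSD
formula for every rank `≤ 1` curve in class `C`" assembled STRICTLY from published theorems — so
that the rank-`≤ 1` remainder becomes exactly the CONSTRUCTION-SHAPED classes, which are TYPED
(missing-input `Prop`s), NOT attempted. This is not "finishing BSD". Team N8/O2 = `x11b3`, seat
`b2b-bsdres-x11b3-p3` (GEN 3), LEAD DEAL #6 A6.2 (2) / A6.3 (3), sub-target S15 (ii) "the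
non-split node with `[k : k_v]` odd", part 1 of 2. THEOREMS ONLY: no definition, no named fact,
no `sorry`; nothing is booked; the flag `JET@p|N` is NOT discharged.

## What

x11b3-p4's `GoodReductionSubgroupNodeFrobenius` / `GoodReductionSubgroupNodeH1` (parts 4–5 of
the JET3-KUMMER help-wanted (α)) treat a multiplicative place whose node is PRESENTED OVER THE
RESIDUE FIELD `k` of `R` (`W₀ mod 𝔪 = singularModel x₀ y₀ α₁ α₂`, `α₁ ≠ α₂ ∈ k`). At a
NON-split multiplicative place of `K_v` with `[k : k_v]` odd the node stays non-split over `k`: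
its tangent slopes are conjugate in the quadratic extension of `k` and no such presentation
exists. This file redoes the two ingredients for a node presented over an ARBITRARY FIELD
`k' ⊇ k` along `j : k →+* k'`, in the tree's currency of `SplitNodeQuadraticProofs`
(`(W₀.map (IsLocalRing.residue R)).map j = singularModel x₀ y₀ α₁ α₂`):

* §0 `not_mem_range_of_not_splits` — **non-split ⇒ the slopes are not `k`-rational**: if
  Mathlib's splitting quadratic of `W₀ mod 𝔪` does NOT split over `k` (the negation of
  `HasSplitMultiplicativeReduction`'s field) then `α₁ ∉ j(k)` (else `α₂ = −j ā₁ − α₁ ∈ j(k)` too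
  and the quadratic `c̄₄(T − α₁)(T − α₂)` splits over `k`; tree `SplitNodeQuadraticProofs`).
* §1 `exists_addMonoidHom_units_of_map_map_eq_singularModel` — **`r = ψ ∘ (j on points) ∘
  (reduction)` is a homomorphism `E₀(L) → k'ˣ` with kernel `E₁(L)`, given on integral points
  with non-singular reduction by `r(a, b) = ψ(j ā, j b̄)`** (tree
  `exists_addMonoidHom_units_of_map_eq_singularModel` with the point map `mapPoint j` of
  `FrobeniusTwist` inserted; `ψ = singularModel.nodeFun`, Silverman *AEC* III.2.5(a), VII.2.1).
* §2 `exists_residueMap_nodeReduction_smul_ext` — **the Galois rule**: for `σ ∈ Aut(L/F)`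
  (all of `Aut(L/F)` preserving `R`, hypothesis `hR`) there is the residue endomorphism
  `σ̄ : k →+* k`, `σ̄ ā = \overline{σ a}`, and for EVERY ring endomorphism `σ'` of `k'`
  compatible with it (`σ' ∘ j = j ∘ σ̄`; over finite fields: `σ̄ = Frob_q`, `σ' = Frob_q` of
  `k'`) `σ'` fixes `x₀, y₀` and EITHER fixes both slopes and `r(σ • P) = σ'(r P)` on `E₀(L)`, OR
  swaps them and `r(σ • P) = σ'(r P)⁻¹` — x11b3-p4's `exists_residueMap_nodeReduction_smul`
  (= the tree's `WeierstrassCurve.exists_residueMap_nodeReduction_smul`, Silverman *AEC*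
  Exercise 3.5(a)) generalised from `k` to `k' ⊇ k`; same mechanism (`σ'` fixes the reduced
  equation, hence its singular point, and permutes the tangent slopes —
  `singularModel.apply_eq_of_map_eq`; `ψ` under ring maps — unfolding `singularModel.nodeFun`;
  `r = 1` on `E₁`).

Part 2 (`GoodReductionSubgroupNodeH1Nonsplit`) feeds these into Hilbert 90 on the norm-one torus
`{u ∈ k'ˣ : u^{qⁿ+1} = 1}` (`#k = qⁿ`, `n` odd) to discharge the stub `h1red` at such a place.

References (locators only; no new fact): [cite: SilvermanAEC2009, Exercise 3.5(a) (PDF p. 97),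
VII.§5 (PDF p. 174), VII.2 Prop. 2.1 and Prop. III.2.5(a) (PDF pp. 167, 59)]
[cite: NeukirchANT1999, Ch. II §9 (decomposition group and residue field)].

## Design

No definitions; `noncomputable section`; `open scoped Classical`; universe `u` for `F`, `L`;
`R` abstract with `hv = integers_valuationRing_valuation R L` supplied inline; `k'` any field.
Axioms: `propext`, `Classical.choice`, `Quot.sound`.
-/

noncomputable section

open scoped Classical

namespace Summit.BirchSwinnertonDyer.Rank1Residual.X11b.Three.JetchevKummer

open WeierstrassCurve Literature.NumberTheory.EllipticCurves

universe u

variable {F : Type u} [Field F] (X : WeierstrassCurve F) (L : Type u) [Field L] [Algebra F L]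
  (R : Type*) [CommRing R] [IsDomain R] [IsDiscreteValuationRing R] [Algebra R L]
  [IsFractionRing R L] (W₀ : WeierstrassCurve R) (hX : X.baseChange L = W₀.baseChange L)
  {k' : Type*} [Field k'] (j : IsLocalRing.ResidueField R →+* k')

/-! ### §0 Non-split nodes: the slopes are not `k`-rational -/

/-- **Non-split ⇒ the tangent slopes are not `k`-rational.** For a Weierstrass equation `W₀`
over a local ring `R` whose reduction pushed along `j : k →+* k'` is `singularModel x₀ y₀ α₁ α₂`
with `c̄₄ ≠ 0` (a node): if Mathlib's splitting quadratic
`c₄T² + a₁c₄T − (54b₆ − 3b₂b₄ + a₂c₄) mod 𝔪` does not split over `k` (NON-split node, the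
negation of the field of `WeierstrassCurve.HasSplitMultiplicativeReduction`), then `α₁ ∉ j(k)`:
otherwise `α₂ = −j ā₁ − α₁ ∈ j(k)` as well and the quadratic, which is `c̄₄(T − α₁)(T − α₂)` over
`k'` (tree `map_map_splittingQuadratic_eq_of_eq_singularModel`), splits over `k`. Silverman, *AEC*
VII.§5 ("nonsplit" = slopes not in `k`). [cite: SilvermanAEC2009, VII.§5 (PDF p. 174)] -/
theorem not_mem_range_of_not_splits {x₀ y₀ α₁ α₂ : k'}
    (hW : (W₀.map (IsLocalRing.residue R)).map j = singularModel x₀ y₀ α₁ α₂)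
    (hc₄ : IsLocalRing.residue R W₀.c₄ ≠ 0)
    (hns : ¬ ((Polynomial.C W₀.c₄ * Polynomial.X ^ 2 + Polynomial.C (W₀.a₁ * W₀.c₄) * Polynomial.X -
      Polynomial.C (54 * W₀.b₆ - 3 * W₀.b₂ * W₀.b₄ + W₀.a₂ * W₀.c₄)).map
        (algebraMap R (IsLocalRing.ResidueField R))).Splits) :
    α₁ ∉ Set.range j := by
  rintro ⟨t₁, ht₁⟩
  -- the other slope is `k`-rational too: `α₁ + α₂ = −j ā₁`
  have ha₁ : j (W₀.map (IsLocalRing.residue R)).a₁ = -(α₁ + α₂) := by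
    have h := congrArg WeierstrassCurve.a₁ hW
    rwa [map_a₁] at h
  have ht₂ : j (-(W₀.map (IsLocalRing.residue R)).a₁ - t₁) = α₂ := by
    rw [map_sub, map_neg, ha₁, ht₁]; ring
  apply hns
  have hQ := map_map_splittingQuadratic_eq_of_eq_singularModel W₀ j hW
  have hc : j (IsLocalRing.residue R W₀.c₄) ≠ 0 := (map_ne_zero j).mpr hc₄
  refine Polynomial.Splits.of_splits_map j ?_ ?_
  · rw [hQ]
    exact ((Polynomial.Splits.X_sub_C α₁).mul (Polynomial.Splits.X_sub_C α₂)).C_mul _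
  · intro a ha
    rw [hQ, Polynomial.mem_roots (mul_ne_zero (Polynomial.C_ne_zero.mpr hc)
      (mul_ne_zero (Polynomial.X_sub_C_ne_zero α₁) (Polynomial.X_sub_C_ne_zero α₂))),
      Polynomial.IsRoot.def] at ha
    simp only [Polynomial.eval_mul, Polynomial.eval_C, Polynomial.eval_sub, Polynomial.eval_X] at ha
    rcases mul_eq_zero.mp ha with h | h
    · exact (hc h).elim
    · rcases mul_eq_zero.mp h with h | h
      · rw [sub_eq_zero] at h; rw [h]; exact RingHom.mem_range.mpr ⟨t₁, ht₁⟩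
      · rw [sub_eq_zero] at h; rw [h]; exact RingHom.mem_range.mpr ⟨_, ht₂⟩

/-! ### §1 The node reduction map for a node presented over `k' ⊇ k` -/

/-- **Multiplicative reduction, explicitly: `E₀(L) → k'ˣ` through the node map, for a node
presented over an extension `k'` of the residue field.**  Let `W₀` be a Weierstrass equation over
the discrete valuation ring `R` of `L` whose reduction, pushed into the field `k'` along
`j : k →+* k'`, is the singular model `singularModel x₀ y₀ α₁ α₂` with `α₁ ≠ α₂` (a node whose
tangent slopes lie in `k'`, e.g. a non-split node and `k'` the quadratic extension of `k`). Then
`r = ψ ∘ j ∘ (reduction)` — the reduction homomorphism `E₀(L) → Ẽ_ns(k)` (Silverman *AEC*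
VII.2.1, tree `reductionHom`), the point map along `j` (tree `mapPoint`), Silverman's node map
`ψ : Ẽ_ns(k') ≅ k'ˣ` (*AEC* III.2.5(a), tree `singularModel.nodeHom`) — is a homomorphism
`E₀(L) → k'ˣ` with kernel exactly `E₁(L)` and given on the points with integral coordinates and
non-singular reduction by `r(a, b) = ψ(j ā, j b̄)`. The case `k' = k`, `j = id` is the tree's
`exists_addMonoidHom_units_of_map_eq_singularModel`.
[cite: SilvermanAEC2009, VII.2 Prop. 2.1 and Prop. III.2.5(a) (PDF pp. 167, 59)] -/
theorem exists_addMonoidHom_units_of_map_map_eq_singularModel {x₀ y₀ α₁ α₂ : k'}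
    (hW : (W₀.map (IsLocalRing.residue R)).map j = singularModel x₀ y₀ α₁ α₂) (hα : α₁ ≠ α₂) :
    ∃ r : W₀.nonsingularReductionSubgroup (integers_valuationRing_valuation R L) →+ Additive k'ˣ,
      (∀ P : W₀.nonsingularReductionSubgroup (integers_valuationRing_valuation R L),
          r P = 0 ↔ W₀.ReducesToZero (P : (W₀.baseChange L).toAffine.Point)) ∧
      ∀ (a b : R) (h : (W₀.baseChange L).toAffine.Nonsingular (algebraMap R L a) (algebraMap R L b))
        (hns : (singularModel x₀ y₀ α₁ α₂).toAffine.Nonsingular (j (IsLocalRing.residue R a))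
          (j (IsLocalRing.residue R b)))
        (hP : W₀.HasNonsingularReduction (.some _ _ h)),
        ((r ⟨.some _ _ h, hP⟩).toMul : k') = singularModel.nodeFun x₀ y₀ α₁ α₂ (.some _ _ hns) := by
  have hv := integers_valuationRing_valuation R L
  let r : W₀.nonsingularReductionSubgroup hv →+ Additive k'ˣ :=
    (singularModel.nodeHom x₀ y₀ α₁ α₂).comp ((mapPoint j hW).comp (W₀.reductionHom hv))
  have hr : ∀ P : W₀.nonsingularReductionSubgroup hv,
      r P = singularModel.nodeHom x₀ y₀ α₁ α₂
        (mapPoint j hW (W₀.reducePoint (P : (W₀.baseChange L).toAffine.Point))) := fun _ ↦ rfl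
  refine ⟨r, fun P ↦ ?_, fun a b h hns hP ↦ ?_⟩
  · rw [hr, ← reducePoint_eq_zero_iff hv P.2, ← (singularModel.nodeHom x₀ y₀ α₁ α₂).map_zero,
      (singularModel.nodeHom_injective hα).eq_iff, ← (mapPoint j hW).map_zero,
      (mapPoint_injective j hW).eq_iff]
  · have hns'' : ((W₀.map (IsLocalRing.residue R)).map j).toAffine.Nonsingular
        (j (IsLocalRing.residue R a)) (j (IsLocalRing.residue R b)) := by rw [hW]; exact hns
    have hns' : (W₀.map (IsLocalRing.residue R)).toAffine.Nonsingular (IsLocalRing.residue R a)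
        (IsLocalRing.residue R b) := (Affine.map_nonsingular _ j.injective _ _).mp hns''
    have hred : W₀.reducePoint ((⟨.some _ _ h, hP⟩ : W₀.nonsingularReductionSubgroup hv) :
        (W₀.baseChange L).toAffine.Point) = .some _ _ hns' :=
      reducePoint_some_algebraMap hv.hom_inj h hns'
    rw [hr, hred, mapPoint_some, singularModel.coe_toMul_nodeHom]

/-! ### §2 The decomposition group acts on the node reduction map through `(σ̄, σ')` -/

include hX in
/-- **An automorphism preserving `R` acts on `r = ψ ∘ j ∘ reduction` through the residue
fields, equivariantly or anti-equivariantly** — Silverman, *AEC*, Exercise 3.5(a), for a node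
presented over an extension `k' ⊇ k` of the residue field. Let `X / F`, `L ⊇ F` with discrete
valuation ring `R` (`Frac R = L`) such that every `τ ∈ Aut(L/F)` maps `R` into `R` (`hR`), `W₀`
an `R`-model of `X ⊗ L` (`hX`) whose reduction pushed along `j : k →+* k'` is a presented node
`singularModel x₀ y₀ α₁ α₂` (`hW`), and `r : E₀ →+ k'ˣ` a homomorphism with kernel `E₁` (`hr0`)
given on integral points by `r(a, b) = ψ(j ā, j b̄)` (`hr`; such an `r` is
`exists_addMonoidHom_units_of_map_map_eq_singularModel`). Then for `σ ∈ Aut(L/F)` there is a ring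
endomorphism `σ̄` of `k` with `σ̄ ā = \overline{σ a}` (`a ∈ R`), and for EVERY ring endomorphism
`σ'` of `k'` with `σ' ∘ j = j ∘ σ̄`: `σ'` fixes `x₀, y₀`, and EITHER `σ' α₁ = α₁`, `σ' α₂ = α₂`
and `r(σ • P) = σ' (r P)` for all `P ∈ E₀` (the node splits over the fixed field of `σ'`), OR
`σ' α₁ = α₂`, `σ' α₂ = α₁` and `r(σ • P) = σ' (r P)⁻¹`. The case `k' = k` is x11b3-p4's
`exists_residueMap_nodeReduction_smul` (tree: `WeierstrassCurve.exists_residueMap_nodeReduction_smul`).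
[cite: SilvermanAEC2009, Exercise 3.5(a) and VII.§5 (PDF pp. 97, 174)]
[cite: NeukirchANT1999, Ch. II §9] -/
theorem exists_residueMap_nodeReduction_smul_ext
    (hR : ∀ (τ : L ≃ₐ[F] L) (x : L), x ∈ Set.range (algebraMap R L) →
      τ x ∈ Set.range (algebraMap R L))
    (σ : L ≃ₐ[F] L) {x₀ y₀ α₁ α₂ : k'}
    (hW : (W₀.map (IsLocalRing.residue R)).map j = singularModel x₀ y₀ α₁ α₂)
    (r : W₀.nonsingularReductionSubgroup (integers_valuationRing_valuation R L) →+ Additive k'ˣ)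
    (hr0 : ∀ P : W₀.nonsingularReductionSubgroup (integers_valuationRing_valuation R L),
      r P = 0 ↔ W₀.ReducesToZero (P : (W₀.baseChange L).toAffine.Point))
    (hr : ∀ (a b : R)
      (h : (W₀.baseChange L).toAffine.Nonsingular (algebraMap R L a) (algebraMap R L b))
      (hns : (singularModel x₀ y₀ α₁ α₂).toAffine.Nonsingular (j (IsLocalRing.residue R a))
        (j (IsLocalRing.residue R b)))
      (hP : W₀.HasNonsingularReduction (.some _ _ h)),
      ((r ⟨.some _ _ h, hP⟩).toMul : k') = singularModel.nodeFun x₀ y₀ α₁ α₂ (.some _ _ hns)) :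
    ∃ σk : IsLocalRing.ResidueField R →+* IsLocalRing.ResidueField R,
      (∀ a a' : R, algebraMap R L a' = σ (algebraMap R L a) →
        σk (IsLocalRing.residue R a) = IsLocalRing.residue R a') ∧
      ∀ σ' : k' →+* k', (∀ t, σ' (j t) = j (σk t)) →
        σ' x₀ = x₀ ∧ σ' y₀ = y₀ ∧
        ((σ' α₁ = α₁ ∧ σ' α₂ = α₂ ∧
          ∀ (P : (X.baseChange L).toAffine.Point)
            (hP : W₀.HasNonsingularReduction (Affine.Point.congrEquiv hX P))
            (hσP : W₀.HasNonsingularReduction (Affine.Point.congrEquiv hX (σ • P))),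
            ((r ⟨_, hσP⟩).toMul : k') = σ' ((r ⟨_, hP⟩).toMul : k')) ∨
         (σ' α₁ = α₂ ∧ σ' α₂ = α₁ ∧
          ∀ (P : (X.baseChange L).toAffine.Point)
            (hP : W₀.HasNonsingularReduction (Affine.Point.congrEquiv hX P))
            (hσP : W₀.HasNonsingularReduction (Affine.Point.congrEquiv hX (σ • P))),
            ((r ⟨_, hσP⟩).toMul : k') = (σ' ((r ⟨_, hP⟩).toMul : k'))⁻¹)) := by
  have hv := integers_valuationRing_valuation R L
  have hinj : Function.Injective (algebraMap R L) := IsFractionRing.injective R L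
  -- `σ` restricted to `R`: a local endomorphism (its inverse `σ⁻¹` also preserves `R`)
  have hex : ∀ a : R, ∃ a' : R, algebraMap R L a' = σ (algebraMap R L a) := fun a ↦ by
    obtain ⟨a', ha'⟩ := hR σ (algebraMap R L a) ⟨a, rfl⟩
    exact ⟨a', ha'⟩
  choose f hf using hex
  let σR : R →+* R :=
    { toFun := f
      map_one' := hinj (by simp only [hf, map_one])
      map_mul' := fun a b ↦ hinj (by simp only [hf, map_mul])
      map_zero' := hinj (by simp only [hf, map_zero])
      map_add' := fun a b ↦ hinj (by simp only [hf, map_add]) }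
  have hσR : ∀ a : R, algebraMap R L (σR a) = σ (algebraMap R L a) := hf
  haveI : IsLocalHom σR := by
    refine ⟨fun a ha ↦ ?_⟩
    obtain ⟨b, hb⟩ := isUnit_iff_exists_inv.mp ha
    obtain ⟨b', hb'⟩ := hR σ⁻¹ (algebraMap R L b) ⟨b, rfl⟩
    refine isUnit_iff_exists_inv.mpr ⟨b', hinj ?_⟩
    rw [map_mul, map_one, hb']
    have h1 : σ (algebraMap R L a) * algebraMap R L b = 1 := by
      rw [← hσR, ← map_mul, hb, map_one]
    have h2 := congrArg (σ⁻¹ : L ≃ₐ[F] L) h1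
    rw [map_mul, map_one] at h2
    rwa [show (σ⁻¹ : L ≃ₐ[F] L) (σ (algebraMap R L a)) = algebraMap R L a from
      σ.symm_apply_apply _] at h2
  set σk : IsLocalRing.ResidueField R →+* IsLocalRing.ResidueField R :=
    IsLocalRing.ResidueField.map σR with hσkdef
  have hσk : ∀ a : R, σk (IsLocalRing.residue R a) = IsLocalRing.residue R (σR a) := fun a ↦
    IsLocalRing.ResidueField.map_residue σR a
  -- `σ` fixes the coefficients of `W₀` (they come from `F`), so `σ̄` fixes the reduction
  have hcoef : ∀ {c : R} {x : F}, algebraMap F L x = algebraMap R L c → σR c = c := by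
    intro c x hcx
    exact hinj (by rw [hσR, ← hcx, AlgEquiv.commutes])
  have hWσ : W₀.map σR = W₀ := by
    have h1 := congrArg WeierstrassCurve.a₁ hX
    have h2 := congrArg WeierstrassCurve.a₂ hX
    have h3 := congrArg WeierstrassCurve.a₃ hX
    have h4 := congrArg WeierstrassCurve.a₄ hX
    have h6 := congrArg WeierstrassCurve.a₆ hX
    simp only [baseChange, map_a₁, map_a₂, map_a₃, map_a₄, map_a₆] at h1 h2 h3 h4 h6
    ext
    · exact hcoef h1
    · exact hcoef h2
    · exact hcoef h3
    · exact hcoef h4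
    · exact hcoef h6
  have hWk0 : (W₀.map (IsLocalRing.residue R)).map σk = W₀.map (IsLocalRing.residue R) := by
    rw [map_map, hσkdef, IsLocalRing.ResidueField.map_comp_residue, ← map_map, hWσ]
  -- residues of `σ`-moved integers
  have hσres : ∀ a a' : R, algebraMap R L a' = σ (algebraMap R L a) →
      σk (IsLocalRing.residue R a) = IsLocalRing.residue R a' := by
    intro a a' h
    rw [hσk, show σR a = a' from hinj (by rw [hσR, h])]
  refine ⟨σk, hσres, fun σ' hσ'j ↦ ?_⟩
  -- `σ'` fixes the presented node
  have hcomp : σ'.comp j = j.comp σk := RingHom.ext hσ'j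
  have hWk : (singularModel x₀ y₀ α₁ α₂).map σ' = singularModel x₀ y₀ α₁ α₂ := by
    rw [← hW, map_map, hcomp, ← map_map, hWk0]
  obtain ⟨hx₀, hy₀, hslopes⟩ := singularModel.apply_eq_of_map_eq hWk
  -- the moved point, on coordinates
  have hsmul : ∀ {x y : L} (h : (X.baseChange L).toAffine.Nonsingular x y),
      ∃ h' : (X.baseChange L).toAffine.Nonsingular (σ x) (σ y), σ • (Affine.Point.some x y h) =
        .some _ _ h' := by
    intro x y h
    rw [WeierstrassCurve.smul_def, Affine.Point.map_some]
    exact ⟨_, rfl⟩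
  have hmove : ∀ {x y : L} (h : (X.baseChange L).toAffine.Nonsingular x y),
      ∃ h' : (W₀.baseChange L).toAffine.Nonsingular (σ x) (σ y),
        Affine.Point.congrEquiv hX (σ • (Affine.Point.some x y h)) = .some _ _ h' := by
    intro x y h
    obtain ⟨h₁, hh₁⟩ := hsmul h
    rw [hh₁, Affine.Point.congrEquiv_some]
    exact ⟨_, rfl⟩
  have hfix : ∀ {x y : L} (h : (X.baseChange L).toAffine.Nonsingular x y),
      ∃ h' : (W₀.baseChange L).toAffine.Nonsingular x y,
        Affine.Point.congrEquiv hX (.some x y h) = .some _ _ h' := by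
    intro x y h
    rw [Affine.Point.congrEquiv_some]
    exact ⟨_, rfl⟩
  -- integral points: reduction of `(a, b)` read in `k'`
  have hns_iff : ∀ {a b : R}
      (h : (W₀.baseChange L).toAffine.Nonsingular (algebraMap R L a) (algebraMap R L b)),
      W₀.HasNonsingularReduction (.some _ _ h) ↔
        (singularModel x₀ y₀ α₁ α₂).toAffine.Nonsingular (j (IsLocalRing.residue R a))
          (j (IsLocalRing.residue R b)) := by
    intro a b h
    rw [hasNonsingularReduction_some_algebraMap_iff hinj h,
      ← Affine.map_nonsingular _ j.injective (IsLocalRing.residue R a) (IsLocalRing.residue R b)]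
    exact Iff.of_eq (by rw [← hW])
  -- a non-integral `x` stays non-integral under `σ` (`σ⁻¹` preserves `R`)
  have hnonint : ∀ {x : L}, x ∉ Set.range (algebraMap R L) → σ x ∉ Set.range (algebraMap R L) := by
    intro x hx hσx
    apply hx
    obtain ⟨c, hc⟩ := hR σ⁻¹ (σ x) hσx
    exact ⟨c, by rw [hc]; exact σ.symm_apply_apply x⟩
  -- integral coordinates: `x = a`, `y = b`, `σ x = σR a`, `σ y = σR b`
  have hint : ∀ {x y : L}, (W₀.baseChange L).toAffine.Nonsingular x y →
      x ∈ Set.range (algebraMap R L) →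
        ∃ a b : R, algebraMap R L a = x ∧ algebraMap R L b = y ∧
          algebraMap R L (σR a) = σ x ∧ algebraMap R L (σR b) = σ y := by
    rintro x y h ⟨a, rfl⟩
    have hy : ValuationRing.valuation R L y ≤ 1 :=
      v_Y_le_one_of_v_X_le_one hv h.1 (hv.map_le_one a)
    obtain ⟨b, rfl⟩ := hv.exists_of_le_one hy
    exact ⟨a, b, rfl, rfl, hσR a, hσR b⟩
  refine ⟨hx₀, hy₀, ?_⟩
  -- `r = 1` on `E₁`
  have hone : ∀ (Q : (W₀.baseChange L).toAffine.Point) (hQ : W₀.HasNonsingularReduction Q),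
      W₀.ReducesToZero Q → ((r ⟨Q, hQ⟩).toMul : k') = 1 := by
    intro Q hQ h0
    have := (hr0 ⟨Q, hQ⟩).mpr h0
    rw [this, toMul_zero, Units.val_one]
  -- the value of `r` on a moved point (points generalized, so that `subst` applies)
  have key : ∀ (Q Qσ : (W₀.baseChange L).toAffine.Point) (hQ : W₀.HasNonsingularReduction Q)
      (hQσ : W₀.HasNonsingularReduction Qσ) (P : (X.baseChange L).toAffine.Point),
      Affine.Point.congrEquiv hX P = Q →
      Affine.Point.congrEquiv hX (σ • P) = Qσ →
      ((σ' α₁ = α₁ ∧ σ' α₂ = α₂) →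
        ((r ⟨Qσ, hQσ⟩).toMul : k') = σ' ((r ⟨Q, hQ⟩).toMul : k')) ∧
      ((σ' α₁ = α₂ ∧ σ' α₂ = α₁) →
        ((r ⟨Qσ, hQσ⟩).toMul : k') = (σ' ((r ⟨Q, hQ⟩).toMul : k'))⁻¹) := by
    intro Q Qσ hQ hQσ P hPQ hPQσ
    rcases P with _ | ⟨x, y, h⟩
    · -- `P = O`: both sides are `1`
      have hQ0 : Q = 0 := by
        rw [← hPQ, show (Affine.Point.zero : (X.baseChange L).toAffine.Point) = 0 from rfl, map_zero]
      have hQσ0 : Qσ = 0 := by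
        rw [← hPQσ, show (Affine.Point.zero : (X.baseChange L).toAffine.Point) = 0 from rfl,
          smul_zero, map_zero]
      subst hQ0
      subst hQσ0
      rw [hone 0 hQσ reducesToZero_zero, map_one, inv_one]
      exact ⟨fun _ ↦ rfl, fun _ ↦ rfl⟩
    · obtain ⟨h', hh'⟩ := hmove h
      obtain ⟨h₀, hh₀⟩ := hfix h
      rw [hh₀] at hPQ
      rw [hh'] at hPQσ
      subst hPQ
      subst hPQσ
      by_cases hx : x ∈ Set.range (algebraMap R L)
      · -- integral point: `r (a, b) = ψ(j ā, j b̄)`, `r (σ a, σ b) = ψ(σ' (j ā), σ' (j b̄))`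
        obtain ⟨a, b, rfl, rfl, hσa, hσb⟩ := hint h₀ hx
        have h'' : (W₀.baseChange L).toAffine.Nonsingular (algebraMap R L (σR a))
            (algebraMap R L (σR b)) := by rw [hσa, hσb]; exact h'
        have hQσ' : W₀.HasNonsingularReduction (.some _ _ h'') := by
          rw [← point_some_congr (h := h') (h' := h'') hσa.symm hσb.symm]
          exact hQσ
        have hns := (hns_iff h₀).mp hQ
        have hσns' := singularModel.nonsingular_map σ' hns
        rw [hx₀, hy₀, hσ'j, hσ'j, hσk, hσk] at hσns'
        have hrP : ((r ⟨.some _ _ h₀, hQ⟩).toMul : k') =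
            singularModel.nodeFun x₀ y₀ α₁ α₂ (.some _ _ hns) := hr a b h₀ hns hQ
        have eQσ : (⟨.some (σ (algebraMap R L a)) (σ (algebraMap R L b)) h', hQσ⟩ :
            W₀.nonsingularReductionSubgroup hv) = ⟨.some _ _ h'', hQσ'⟩ :=
          Subtype.ext (point_some_congr hσa.symm hσb.symm)
        rw [eQσ, hrP]
        constructor
        · rintro ⟨h₁, h₂⟩
          have hσns : (singularModel x₀ y₀ α₁ α₂).toAffine.Nonsingular
              (j (IsLocalRing.residue R (σR a))) (j (IsLocalRing.residue R (σR b))) := by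
            rw [h₁, h₂] at hσns'; exact hσns'
          rw [hr (σR a) (σR b) h'' hσns hQσ']
          simp only [singularModel.nodeFun, map_div₀, map_sub, map_mul, hσ'j, hσk, hx₀, hy₀, h₁,
            h₂]
        · rintro ⟨h₁, h₂⟩
          have hσns : (singularModel x₀ y₀ α₁ α₂).toAffine.Nonsingular
              (j (IsLocalRing.residue R (σR a))) (j (IsLocalRing.residue R (σR b))) := by
            rw [h₁, h₂] at hσns'
            exact singularModel.nonsingular_swap (α₁ := α₂) (α₂ := α₁) hσns'
          rw [hr (σR a) (σR b) h'' hσns hQσ']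
          simp only [singularModel.nodeFun, map_div₀, map_sub, map_mul, hσ'j, hσk, hx₀, hy₀, h₁,
            h₂, inv_div]
      · -- a point of `E₁`: both sides are `1`
        have h0P : W₀.ReducesToZero (.some x y h₀) := (reducesToZero_some_iff h₀).mpr hx
        have h0σ : W₀.ReducesToZero (.some (σ x) (σ y) h') :=
          (reducesToZero_some_iff h').mpr (hnonint hx)
        rw [hone _ hQσ h0σ, hone _ hQ h0P, map_one, inv_one]
        exact ⟨fun _ ↦ rfl, fun _ ↦ rfl⟩
  rcases hslopes with ⟨h₁, h₂⟩ | ⟨h₁, h₂⟩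
  · exact Or.inl ⟨h₁, h₂, fun P hP hσP ↦ (key _ _ hP hσP P rfl rfl).1 ⟨h₁, h₂⟩⟩
  · exact Or.inr ⟨h₁, h₂, fun P hP hσP ↦ (key _ _ hP hσP P rfl rfl).2 ⟨h₁, h₂⟩⟩

end Summit.BirchSwinnertonDyer.Rank1Residual.X11b.Three.JetchevKummer

end
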